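import Summits.CriticalPhenomena.CardyFormulaZ2.Theses.CardyRotToConf
import Literature.Probability.RandomPlanarGeometry.CritPercSLE
import Mathlib.InformationTheory.KullbackLeibler.Basic

/-!
# Sketch — crux-ideate stmt-CriticalPhenomena-0698 (CardyRotToConfR2SymmetryUpgrade), ideator 3

First lemmas of the two idea cards `bending-information-gap` and `crossing-data-scalarise`,
stated as `Prop`s over existing declarations (nothing is proved here; the point is that they
elaborate). The crux itself is `Summit.CriticalPhenomena.CardyFormulaZ2.Theses.CardyRotToConf.
CardyRotToConfR2SymmetryUpgrade` and is NOT restated.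
-/

noncomputable section

namespace Summit.CriticalPhenomena.CardyFormulaZ2.Cruxes.CardyRotToConf_r2_symmetryUpgrade.Sketch

open MeasureTheory Set
open scoped ENNReal
open Literature.Probability.RandomPlanarGeometry
open UpperHalfPlane (upperHalfPlaneSet)

/-! ### Shared set-up: the conjugate family and the non-tracing clause of the crux -/

/-- The clause "P-a.s. no non-trivial sub-arc of the curve lies in `∂D`", verbatim from the
crux hypothesis, as a predicate on families. -/
def NonTracing (P : ChordalFamily) : Prop :=
  ∀ D : DobrushinDomain, ∀ᵐ γ ∂(P D), ∀ c : Curve ℂ, CurveClass.mk c = γ →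
    ∀ s t : unitInterval, s < t → c '' Set.Icc s t ⊆ frontier D.carrier →
      (c '' Set.Icc s t).Subsingleton

/-- The **conjugate family** `P^φ D := (φ⁻¹)_* P(φ D)` of a chordal family under a plane
homeomorphism `φ` (intended use: `φ` conformal on a neighbourhood of `closure D`). -/
def conj (P : ChordalFamily) (φ : ℂ ≃ₜ ℂ) : ChordalFamily :=
  fun D => (P (D.map φ)).map (CurveClass.map (φ.symm : C(ℂ, ℂ)))

/-- Structural lemma shared by both cards (provable now, pure transport of structure):
chordality, locality, target independence, the domain Markov property and non-tracing are
natural under conjugation by ANY plane homeomorphism; only similarity covariance singles out the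
similarity group. Consequently the "upgrade" content of R2 is exactly `conj P φ = P` locally for
conformal `φ`, and the fixed-stretch family `conj SLE₆ A` (A linear, non-conformal) satisfies
every hypothesis of R2 except rotation covariance (tightness: any proof must use rotations). -/
def ConjNatural : Prop :=
  ∀ (P : ChordalFamily) (φ : ℂ ≃ₜ ℂ),
    (P.IsChordal → (conj P φ).IsChordal) ∧
    (P.IsLocal → (conj P φ).IsLocal) ∧
    (P.IsTargetIndependent → (conj P φ).IsTargetIndependent) ∧
    (P.IsDomainMarkov → (conj P φ).IsDomainMarkov) ∧
    (NonTracing P → NonTracing (conj P φ))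

/-- Similarity covariance is invariance under conjugation by similarities. -/
def ConjSimilarityIff : Prop :=
  ∀ P : ChordalFamily, P.IsChordal →
    (P.IsSimilarityCovariant ↔ ∀ (c : ℂ) (hc : c ≠ 0) (w : ℂ), conj P (similarity c hc w) = P)

/-! ### Card 1 `bending-information-gap`: first lemma = KL chain rule along the Markov cut -/

/-- **Bending information** of `P` in `D` under `φ`: `KL(P(φD) ‖ φ_* P D)`. It vanishes for all
Dobrushin `D` inside the region where `φ` is conformal iff `P` is covariant under `φ` there. -/
def bendingInfo (P : ChordalFamily) (φ : ℂ ≃ₜ ℂ) (D : DobrushinDomain) : ℝ≥0∞ :=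
  InformationTheory.klDiv (P (D.map φ)) ((P D).map (CurveClass.map (φ : C(ℂ, ℂ))))

/-- FIRST LEMMA of card 1 (the engine of the telescoping): the Kullback–Leibler chain rule across
one Markov cut. For two families with Markov extensions `Q`, `Q'` and a closed cut set `F`,
`KL(P'D ‖ PD) = KL(past' ‖ past) + E_{P'D}[KL(Q'D(past) ‖ QD(past))]`, past = `stopAt F`.
(Curve classes are recovered from (initial piece, final piece), so this is the KL chain rule for
the pair; Mathlib: `InformationTheory.klDiv`; the compProd chain rule is to be vendored.)
Iterating over a mesh of cuts and bounding each conditional term by the germ response gives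
`bendingInfo ≤ C ε² · E Σ rᵢ² → 0` under the Hellinger-Lipschitz hypothesis of the card. -/
def KLChainRule : Prop :=
  ∀ (P P' : ChordalFamily) (Q Q' : DobrushinDomain → CurveClass ℂ → Measure (CurveClass ℂ)),
    P.IsMarkovExtension Q → P'.IsMarkovExtension Q' →
    ∀ (D : DobrushinDomain) (F : Set ℂ), IsClosed F →
      InformationTheory.klDiv (P' D) (P D) =
        InformationTheory.klDiv ((P' D).map (CurveClass.stopAt F)) ((P D).map (CurveClass.stopAt F)) +
          ∫⁻ γ, InformationTheory.klDiv (Q' D (γ.stopAt F)) (Q D (γ.stopAt F)) ∂(P' D)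

/-- The Markov extension of the conjugate family is the conjugate kernel (transport of
structure); with `KLChainRule` this localises `bendingInfo` to conditional germ terms. -/
def conjKernel (Q : DobrushinDomain → CurveClass ℂ → Measure (CurveClass ℂ)) (φ : ℂ ≃ₜ ℂ) :
    DobrushinDomain → CurveClass ℂ → Measure (CurveClass ℂ) :=
  fun D p => (Q (D.map φ) (p.map (φ : C(ℂ, ℂ)))).map (CurveClass.map (φ.symm : C(ℂ, ℂ)))

def ConjKernelIsMarkov : Prop :=
  ∀ (P : ChordalFamily) (Q : DobrushinDomain → CurveClass ℂ → Measure (CurveClass ℂ)) (φ : ℂ ≃ₜ ℂ),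
    P.IsMarkovExtension Q → (conj P φ).IsMarkovExtension (conjKernel Q φ)

/-- The transfer C⁺ ⇒ (conformal covariance) of card 1, typed shadow: if the bending
information of an admissible family vanishes for every plane homeomorphism that is conformal on a
neighbourhood of the closed domain, the family is conformally covariant in the tree's sense
(`ChordalFamily.IsConformallyCovariant`, all conformal equivalences of Dobrushin domains) — the
extension from globally-defined near-identity conformal bendings to all Riemann maps is the
"chain of near-similarity maps" step of the card. -/
def ZeroBendingInfoUpgrade : Prop :=
  ∀ P : ChordalFamily, IsLocalMarkovChordalFamily P → NonTracing P →
    (∀ (φ : ℂ ≃ₜ ℂ) (D : DobrushinDomain) (U : Set ℂ), IsOpen U → closure D.carrier ⊆ U →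
        DifferentiableOn ℂ (fun z : ℂ => φ z) U → bendingInfo P φ D = 0) →
      P.IsConformallyCovariant

/-! ### Card 2 `crossing-data-scalarise`: first lemmas = LSW hull trick and monotonicity -/

/-- FIRST LEMMA of card 2 (LSW's "locality ⇒ hulls are read off crossing probabilities", the
axiom-level shadow, provable now from `IsLocal` once `stopAt F ⁻¹' hitsBefore I F = hitsBefore I F`
is available): the probability that the curve of `P D` reaches the closed set `I` before touching
`closure (D ∖ D')` equals the same probability for `P D'`. Since for boundary-attached
`A = closure (D ∖ D')` the initial hull avoids `A` iff the initial trace does, these numbers are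
the avoidance functional of the hull at the hitting time of `I`, hence (Choquet, over the
π-system of boundary-attached compacta) determine its law. Uses IsLocal only. -/
def HullAvoidance : Prop :=
  ∀ P : ChordalFamily, P.IsLocal →
    ∀ (D D' : DobrushinDomain), D'.carrier ⊆ D.carrier → D'.pt 0 = D.pt 0 → D'.pt 1 = D.pt 1 →
      ∀ I : Set ℂ, IsClosed I →
        P D (CurveClass.hitsBefore I (closure (D.carrier \ D'.carrier))) =
          P D' (CurveClass.hitsBefore I (closure (D.carrier \ D'.carrier)))

/-- Domain monotonicity of arc-hitting ("crossing") probabilities, from locality alone: shrinking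
the domain and charging the new boundary to the losing arc `J` can only decrease the probability
of reaching `I` first. This is the axiom-level source of the compactness/comparison structure the
card exploits (Helly selection over monotone similarity-invariant crossing functions). -/
def CrossingMonotone : Prop :=
  ∀ P : ChordalFamily, P.IsLocal →
    ∀ (D D' : DobrushinDomain), D'.carrier ⊆ D.carrier → D'.pt 0 = D.pt 0 → D'.pt 1 = D.pt 1 →
      ∀ I J : Set ℂ, IsClosed I → IsClosed J →
        P D' (CurveClass.hitsBefore I (J ∪ closure (D.carrier \ D'.carrier))) ≤
          P D (CurveClass.hitsBefore I J)

/-- The transfer target C⁺ of card 2: **Cardy–Carleson for admissible families** — every family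
satisfying the hypotheses of R2 has Cardy's crossing values in every conformal rectangle (same
shape as the tree's SLE₆ fact `sle_six_measureReal_hitsBefore`, with `IsSLELaw 6` replaced by
the axioms). A scalar, similarity-invariant, domain-monotone (`CrossingMonotone`) unknown. -/
def CardyForAdmissibleFamilies : Prop :=
  ∀ P : ChordalFamily, IsLocalMarkovChordalFamily P → NonTracing P →
    ∀ (R : ConformalRectangle) (φ : ConformalEquiv upperHalfPlaneSet R.carrier) (x : Fin 4 → ℝ),
      R.IsUniformizing φ x →
        (P (R.chord 0 2 (by decide))).real (CurveClass.hitsBefore (R.arc 2) (R.arc 1)) =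
          cardyFunction (crossRatio x)

/-- Card 2's structural half (the determination theorem, informal core stated as a Prop over the
tree's vocabulary): two families satisfying the hypotheses of R2 with the same arc-hitting
probabilities in all Dobrushin sub-configurations coincide. Together with
`CardyForAdmissibleFamilies`, `sle_six_measureReal_hitsBefore` and admissibility of the SLE₆
family this yields R2. -/
def DeterminedByCrossings : Prop :=
  ∀ P P' : ChordalFamily, IsLocalMarkovChordalFamily P → NonTracing P →
    IsLocalMarkovChordalFamily P' → NonTracing P' →
    (∀ (D : MarkedDomain 3),
        P (D.chord 0 1 (by decide)) (CurveClass.hitsBefore (D.arc 1) (D.arc 2)) =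
          P' (D.chord 0 1 (by decide)) (CurveClass.hitsBefore (D.arc 1) (D.arc 2))) →
      P = P'

/-- Sanity: the crux decl is referred to by name (type-checks that the route file is imported). -/
example : Prop := Summit.CriticalPhenomena.CardyFormulaZ2.Theses.CardyRotToConf.CardyRotToConfR2SymmetryUpgrade

end Summit.CriticalPhenomena.CardyFormulaZ2.Cruxes.CardyRotToConf_r2_symmetryUpgrade.Sketch

end
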